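import Mathlib
import HarnessLib
import Literature.Combinatorics.SimpleGraph.IntervalGraphConsecutiveCliques
import Literature.Combinatorics.SimpleGraph.GilmoreHoffman

/-!
# The Gilmore–Hoffman characterisation of interval graphs (Golumbic, Thm. 8.1 (i) ⟺ (ii))

Topic `Literature/Combinatorics/SimpleGraph`.  Twenty-sixth file of the chordal series; it closes
the circle of [Golumbic, *Algorithmic Graph Theory and Perfect Graphs*, Thm. 8.1 (Gilmore–Hoffman
1964)] from its two predecessors: `GilmoreHoffman` proved (i) ⟹ (ii) (an interval graph has no
chordless 4-cycle and `u ↦ v :⟺ b u < a v` transitively orients its complement) and (ii) ⟹ (iii)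
(no chordless 4-cycle + a transitive orientation of the complement ⟹ the maximal cliques admit a
linear order in which the cliques containing any vertex are consecutive, Lemma A), and
`IntervalGraphConsecutiveCliques` proved (iii) ⟺ (i) (Fulkerson–Gross).  Here, for a finite graph:

(i) `G` is an interval graph (`∃ a b : V → ℝ`, `u ∼ v ⟺ u ≠ v ∧ [a u, b u] ∩ [a v, b v] ≠ ∅`)
  ⟺ (ii) every 4-cycle of `G` has a chord AND the complement of `G` admits a transitive orientation
  (`F ⊆ {non-edges}`, every non-edge oriented one way or the other, `F² ⊆ F`).

## Contents

* `exists_intervalRepresentation_of_cycleFour_of_transitiveOrientation` — (ii) ⟹ (i)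
  [Golumbic, Thm. 8.1 (ii) ⟹ (iii) ⟹ (i)].
* **`exists_intervalRepresentation_iff_cycleFour_and_transitiveOrientation`** — (i) ⟺ (ii)
  [Golumbic, Thm. 8.1; Gilmore–Hoffman 1964].

## References

* [Golumbic1980] M. C. Golumbic, *Algorithmic Graph Theory and Perfect Graphs*, Academic Press
  (1980); 2nd ed. (2004), Thm. 8.1.  Read: galaxy `panama:327388177104967` (Ch. 8 §8.1).
* P. C. Gilmore, A. J. Hoffman, *A characterization of comparability graphs and of interval graphs*,
  Canad. J. Math. 16 (1964) 539–548 (attribution only).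
-/

namespace Literature.Combinatorics.SimpleGraph

open _root_.SimpleGraph

variable {V : Type*} {G : _root_.SimpleGraph V}

/-- **(ii) ⟹ (i) of the Gilmore–Hoffman theorem.**  A finite graph in which every 4-cycle
`a b c d` has a chord and whose complement admits a transitive orientation `F` (every non-edge
oriented one way, `F` inside the non-edges, `F² ⊆ F`) is an interval graph: by Lemma A its maximal
cliques are consecutively ordered (`exists_consecutive_maximalCliques_of_transitiveOrientation`),
and consecutive cliques give intervals (`IntervalGraphConsecutiveCliques`).
[cite: Golumbic1980, Thm. 8.1 ((ii) ⟹ (iii) ⟹ (i))] -/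
theorem exists_intervalRepresentation_of_cycleFour_of_transitiveOrientation [Finite V]
    (h4 : ∀ a b c d, a ≠ c → b ≠ d → G.Adj a b → G.Adj b c → G.Adj c d → G.Adj d a →
      G.Adj a c ∨ G.Adj b d)
    {F : V → V → Prop} (hF : ∀ u v, u ≠ v → ¬ G.Adj u v → F u v ∨ F v u)
    (hFE : ∀ u v, F u v → u ≠ v ∧ ¬ G.Adj u v) (hFtr : ∀ u v w, F u v → F v w → F u w) :
    ∃ a b : V → ℝ, ∀ u v, G.Adj u v ↔ u ≠ v ∧ (Set.Icc (a u) (b u) ∩ Set.Icc (a v) (b v)).Nonempty :=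
  exists_intervalRepresentation_iff_exists_consecutive_maximalCliques.2
    (exists_consecutive_maximalCliques_of_transitiveOrientation h4 hF hFE hFtr)

/-- **The Gilmore–Hoffman theorem** [Golumbic, Thm. 8.1 (i) ⟺ (ii)]: a finite graph is an
interval graph iff it contains no chordless 4-cycle and its complement is a comparability graph
(admits a transitive orientation). [cite: Golumbic1980, Thm. 8.1 ((i) ⟺ (ii)); Gilmore–Hoffman 1964] -/
theorem exists_intervalRepresentation_iff_cycleFour_and_transitiveOrientation [Finite V] :
    (∃ a b : V → ℝ, ∀ u v, G.Adj u v ↔ u ≠ v ∧ (Set.Icc (a u) (b u) ∩ Set.Icc (a v) (b v)).Nonempty)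
      ↔ (∀ a b c d, a ≠ c → b ≠ d → G.Adj a b → G.Adj b c → G.Adj c d → G.Adj d a →
            G.Adj a c ∨ G.Adj b d) ∧
        ∃ F : V → V → Prop, (∀ u v, u ≠ v → ¬ G.Adj u v → F u v ∨ F v u) ∧
          (∀ u v, F u v → u ≠ v ∧ ¬ G.Adj u v) ∧ ∀ u v w, F u v → F v w → F u w := by
  constructor
  · rintro ⟨a, b, hadj⟩
    obtain ⟨a', b', hab, hadj'⟩ := exists_intervalRepresentation_le a b hadj
    exact ⟨fun x y z w hxz hyw hxy hyz hzw hwx =>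
        adj_or_adj_of_cycle_four_of_intervalRepresentation a' b' hab hadj' hxz hyw hxy hyz hzw hwx,
      exists_transitiveOrientation_of_intervalRepresentation a' b' hab hadj'⟩
  · rintro ⟨h4, F, hF, hFE, hFtr⟩
    exact exists_intervalRepresentation_of_cycleFour_of_transitiveOrientation h4 hF hFE hFtr

end Literature.Combinatorics.SimpleGraph
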